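import Literature.Algebra.EuclideanLattices.LatticeComplexity
import Literature.Computability.MetaComplexity.PromiseRandReductions
import Literature.Computability.Complexity.CookLevinSAT
import HarnessLib

/-!
# Khot 2005, Thm. 1.1 (constant factors, `ℓ₂`): the decomposition of `gapSVP_const_isNPHardRandomized`

Topic `Algebra/EuclideanLattices` (family `pqc`, trunk T-LATTICE), namespace `Literature.PQC`; glue in
`Literature.Computability.Complexity.PromiseProblem` / `Literature.CplxMeta`. First brick of the decomposition of the named fact
`Literature.Algebra.EuclideanLattices.gapSVP_const_isNPHardRandomized` (`LatticeComplexity.lean`, pqc.S17: for every constant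
`γ₀ ≥ 1`, `GapSVP_{γ₀}` is NP-hard under randomised two-sided-error reductions,
`∀ L ∈ NP, (ofLanguage L).RandPolyTimeReducible (gapSVPPromise γ₀)`).

The printed proof of Khot's Theorem 1.1 (J. ACM 52 (2005), §7.3) is ONE randomised
polynomial-time reduction **from `SAT`**: SAT →(Thm. 3.1, deterministic; Arora–Babai–Stern–Sweedyk
1997) a structured CVP instance →(Thm. 5.1, randomised, BCH lattice + random sub-lattice) a
structured SVP instance →(§§6–7, `k`-fold augmented tensor product, Lemmas 7.1–7.2) a `GapSVP`
instance with gap `2^{Ω(k)}`. Everything *complexity-theoretic* around that reduction is already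
proved in the tree: the Cook–Levin theorem (`Literature.Computability.Complexity.SAT_isNPHard_holds`, `CookLevinSAT.lean`:
every `L ∈ NP` Karp-reduces to `SAT`) and the composition "Karp reduction, then randomised
reduction" (`Literature.Computability.MetaComplexity.PromiseRandReducible.of_isHard`, `PromiseRandReductions.lean`, on top of
`PolyTimeComputable.comp_holds`). This file therefore splits pqc.S17 into

* the named fact `Literature.Algebra.EuclideanLattices.Khot2005_SAT_randReducible_gapSVP` — Khot's reduction itself, for the
  Euclidean norm: for every constant `γ₀ ≥ 1`, `PromiseRandReducible (ofLanguage SAT)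
  (gapSVPPromise fun _ => γ₀)` (the lattice-theoretic content of Thm. 1.1, still to be proved from
  its own printed bricks Thm. 3.1 / Thm. 4.1 / Thm. 5.1 / Lemmas 7.1–7.2, see the plan below), and
* the PROVED implication `Literature.PQC.gapSVP_const_isNPHardRandomized_of_SAT_randReducible :
  Khot2005_SAT_randReducible_gapSVP → gapSVP_const_isNPHardRandomized`, through the general
  PROVED transfer `PromiseProblem.isNPHardRandomized_of_promiseRandReducible_SAT`: every promise
  problem to which `SAT` randomly reduces is NP-hard under randomised reductions.

Also proved: the bridge `PromiseProblem.RandPolyTimeReducible.of_promiseRandReducible` from the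
meta-complexity notion `Literature.Computability.MetaComplexity.PromiseRandReducible` (exact polynomial coin budget) to the
lattice file's `PromiseProblem.RandPolyTimeReducible` (drop the budget clause) and the resulting
`PromiseProblem.IsHard.isRandHard_of_promiseRandReducible`; monotonicity of `PromiseRandReducible`
under weakening the target promise (`PromiseRandReducible.mono_right`), whence a randomised
reduction to `GapSVP_{γ'}` is one to `GapSVP_γ` for `γ ≤ γ'` (`promiseRandReducible_gapSVP_of_le`)
and the equivalence of "every constant" with Khot's "arbitrarily large constant"
(`khot2005_SAT_randReducible_gapSVP_iff`).

## The source, as printed (Khot, J. ACM 52 (2005) 789–808)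

* Thm. 1.1 (p. 791): "Let `p > 1` be any fixed real. Assuming NP ⊄ RP, there is no polynomial
  time algorithm that approximates the Shortest Vector Problem in `ℓ_p` norm within (any) constant
  factor. Assuming NP ⊄ RTIME(`2^{poly(log n)}`), there is no polynomial time algorithm that
  approximates SVP within factor `2^{(log n)^{1/2-ε}}` …". Only the first assertion, for `p = 2`,
  is vendored (the tree's lattices are Euclidean, `Problems.lean`).
* §7.3 (p. 806): "Theorem 3.1 reduces SAT instance of size `n` to a CVP instance of size `d` …
  Theorem 5.1 then reduces the CVP instance to SVP instance … Lemmas 7.1 and 7.2 imply that `L_k` is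
  a gap instance of SVP with gap `(1/(2γ^k))^{1/p} = 2^{Ω(k)}` … we get a hardness factor of
  `2^{Ω(k)}` via a reduction that runs in time `n^{O(k²)}`. Thus, choosing `k` to be a large
  enough constant, we prove an arbitrarily large constant factor hardness for SVP via a
  polynomial-time (randomized) reduction."
* The error is TWO-sided and bounded: Thm. 5.1 (p. 799) "(2) If the CVP instance is a YES
  instance, then with probability at least 9/10 … (3) If the CVP instance is a NO instance, then
  with probability at least 9/10 …" (Lemma 5.6 kills the annoying vectors, Lemmas 5.7–5.8 keep a
  good vector, §5.2.1 samples a prime). This is the notion `PromiseRandReducible` /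
  `RandPolyTimeReducible` (success `≥ 2/3` on each side of the promise); the printed "NP ⊄ RP" is
  the customary phrasing of the consequence (NP ⊆ BPP implies NP = RP, Ko 1982).

## Reading conventions behind the named fact (routine; recorded, not hidden)

1. Khot's bases are integer `M × N` matrices of full column rank, `M ≥ N` (§1.3, p. 792; the
   final instance is `N'^{2k} × N'^k`), whereas a `GapSVPInstance` of `Problems.lean` is a square
   nonsingular integer basis (rows) with a rational threshold `d > 0` (Micciancio–Goldwasser
   conventions). In the `ℓ₂` norm this is without loss: appending the `K`-multiples of an integer
   basis of the orthogonal complement of the span, `K > γ₀ d`, gives a square nonsingular integer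
   basis whose lattice is the orthogonal sum, so `λ₁' = min(λ₁, K·μ)` with `μ ≥ 1` the minimum of
   the (integer) complement part: YES (`λ₁ ≤ d`) and NO (`λ₁ > γ₀ d`) are preserved exactly, by a
   deterministic polynomial-time map (rational linear algebra).
2. The threshold is a rational number between the YES bound `(2γ^k d^k)^{1/2}` (Lemma 7.1) and
   `γ₀⁻¹ ·` the NO bound `d^{k/2}` (Lemma 7.2), available as soon as `(2γ^k)^{-1/2} > γ₀`; a larger
   gap serves every smaller one (`promiseRandReducible_gapSVP_of_le`), so "arbitrarily large
   constant" and "every constant `γ₀ ≥ 1`" agree (`khot2005_SAT_randReducible_gapSVP_iff`).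
3. No-instances of `ofLanguage SAT` are all strings outside `SAT` (unsatisfiable CNF codes and
   non-codes); non-codes are recognised in polynomial time and sent to a fixed NO instance. The
   coin string is padded to an exact polynomial budget `q(|x|)` (Arora–Barak, Def. 7.3).

## Plan of the remaining decomposition (kept in the tenure folder's NOTES.md)

T1 (pure lattice mathematics, provable): augmented tensor product (§6) and the boosting Lemmas
7.1–7.2. T2 (provable): Thm. 3.1 at instance level from a gap Exact-Set-Cover instance;
Lemma 4.2; the counting Lemmas 5.4–5.5; Lemma 5.8 (Chebyshev). T3 (named facts): NP-hardness of
gap Exact Set Cover (PCP machinery, Bellare–Goldwasser–Lund–Russell 1993 as used by ABSS 1997);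
Thm. 4.1 (BCH codes: `d`-wise independent columns with `h = (d/2) log N`); Lemma 4.3; prime
sampling (§5.2.1). T4 (machine level): polynomial running time of every map in Mathlib's `FinTM2`
model (`FP`), including the padding map of convention 1.

## References

* S. Khot, *Hardness of approximating the shortest vector problem in lattices*, J. ACM 52 (2005)
  789–808 (preliminary version FOCS 2004): Thm. 1.1, §1.3, Thm. 3.1, Thm. 4.1, Thm. 5.1,
  Lemmas 5.6–5.8, §6, Lemmas 7.1–7.2, §7.3.
* S. Arora, L. Babai, J. Stern, Z. Sweedyk, *The hardness of approximate optima in lattices,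
  codes, and systems of linear equations*, JCSS 54 (1997) 317–331 (Khot's Thm. 3.1).
* S. Arora, B. Barak, *Computational Complexity: A Modern Approach*, CUP 2009, Def. 7.3, §7.6
  (randomised reductions), Thm. 2.8 (composition), Lemma 2.11 (Cook–Levin).
* K. Ko, *Some observations on the probabilistic algorithms and NP-hard problems*, IPL 14 (1982)
  39–43 (NP ⊆ BPP ⇒ NP = RP).
* D. Micciancio, S. Goldwasser, *Complexity of Lattice Problems*, Kluwer 2002, Ch. 1 §1.2
  (`GapSVP_γ` as a promise problem).
-/

noncomputable section

open Computability Literature.Computability.Complexity Literature.Computability.MetaComplexity Literature.Computability.Complexity.PromiseProblem Literature.Algebra.EuclideanLattices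

/-! ### Glue: from `PromiseRandReducible` (exact coin budget) to `RandPolyTimeReducible` -/

namespace Literature.Algebra.EuclideanLattices
section PromiseProblem
open Literature.Computability.Complexity (PromiseProblem)
open Literature.Computability.Complexity.PromiseProblem

/-- The meta-complexity notion `Literature.CplxMeta.PromiseRandReducible Q₁ Q₂` (PPT many-one reduction
with two-sided error `≤ 1/3` on the promise, reading exactly `q(|x|)` coins) implies verbatim the
lattice file's local glue notion `Q₁.RandPolyTimeReducible Q₂` (same data, no budget clause).
This is the one-line bridge announced in the design notes of `PromiseRandReductions.lean`.
[Arora–Barak 2009, Def. 7.16 with Def. 7.3] [cite: AroraBarak2009, §7.6] -/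
theorem _root_.Literature.Computability.Complexity.PromiseProblem.RandPolyTimeReducible.of_promiseRandReducible {Q₁ Q₂ : PromiseProblem}
    (h : PromiseRandReducible Q₁ Q₂) : Q₁.RandPolyTimeReducible Q₂ := by
  obtain ⟨A, hA, -, hy, hn⟩ := h
  exact ⟨A, hA, hy, hn⟩

/-- **Transfer of hardness to a promise target.** If the promise problem `Q` is `C`-hard under
Karp reductions and `Q` randomly reduces to the promise problem `Q'` (`PromiseRandReducible`),
then `Q'` is `C`-hard under randomised reductions in the sense of `PromiseProblem.IsRandHard`
(every `L ∈ C` satisfies `(ofLanguage L).RandPolyTimeReducible Q'`): compose the Karp reduction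
of `L` to `Q` with the randomised one (`PromiseRandReducible.of_isHard`, proved in
`PromiseRandReductions.lean` from `PolyTimeComputable.comp_holds`) and drop the budget clause.
The promise-target companion of `Literature.Computability.MetaComplexity.IsRandHard.of_isHard_promise`.
[Arora–Barak 2009, §7.6 and Thm. 2.8] [cite: AroraBarak2009, §7.6] -/
theorem _root_.Literature.Computability.Complexity.PromiseProblem.IsHard.isRandHard_of_promiseRandReducible {C : Set (Language Bool)}
    {Q Q' : PromiseProblem} (hQ : Q.IsHard C) (h : PromiseRandReducible Q Q') :
    PromiseProblem.IsRandHard C Q' :=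
  fun _ hL => RandPolyTimeReducible.of_promiseRandReducible (PromiseRandReducible.of_isHard hQ h hL)

/-- **Every promise problem to which `SAT` randomly reduces is NP-hard under randomised
reductions** (`IsNPHardRandomized`): the Cook–Levin theorem (`Literature.Computability.Complexity.SAT_isNPHard_holds`:
`SAT` is NP-hard under Karp reductions, Arora–Barak Lemma 2.11, proved in `CookLevinSAT.lean`)
makes `ofLanguage SAT` an NP-hard promise problem (`isHard_ofLanguage_iff`), and hardness
transfers along the randomised reduction (`IsHard.isRandHard_of_promiseRandReducible`).
[Arora–Barak 2009, Lemma 2.11 and §7.6] [cite: AroraBarak2009, §7.6] -/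
theorem _root_.Literature.Computability.Complexity.PromiseProblem.isNPHardRandomized_of_promiseRandReducible_SAT {Q : PromiseProblem}
    (h : PromiseRandReducible (ofLanguage SAT) Q) : Q.IsNPHardRandomized :=
  IsHard.isRandHard_of_promiseRandReducible
    (isHard_ofLanguage_iff.2 Literature.Computability.Complexity.SAT_isNPHard_holds) h

end PromiseProblem
end Literature.Algebra.EuclideanLattices

/-! ### Glue: weakening the target promise -/

namespace Literature.Algebra.EuclideanLattices

/-- `PromiseRandReducible` is monotone under weakening the target promise: if `Q` randomly
reduces to `Q₁` and `Q₁.yes ⊆ Q₂.yes`, `Q₁.no ⊆ Q₂.no` (as languages, `≤`), the same algorithm randomly reduces `Q`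
to `Q₂` (event probabilities are monotone, Mathlib `MeasureTheory.OuterMeasure.mono`).
[Goldreich 2006, Def. 1.4; Arora–Barak 2009, §7.6] [cite: AroraBarak2009, §7.6] -/
theorem _root_.Literature.Computability.MetaComplexity.PromiseRandReducible.mono_right {Q Q₁ Q₂ : PromiseProblem}
    (h : PromiseRandReducible Q Q₁) (hy : Q₁.yes ≤ Q₂.yes) (hn : Q₁.no ≤ Q₂.no) :
    PromiseRandReducible Q Q₂ := by
  obtain ⟨A, hA, hq, hAy, hAn⟩ := h
  have mono : ∀ (x : List Bool) {E F : Set (List Bool)}, E ⊆ F → A.pr id x E ≤ A.pr id x F := by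
    intro x E F hEF
    unfold RandAlg.pr
    refine ENNReal.toReal_mono ?_ ((A.outputPMF id x).toOuterMeasure.mono hEF)
    refine ne_top_of_le_ne_top ENNReal.one_ne_top ?_
    calc (A.outputPMF id x).toOuterMeasure F
        ≤ (A.outputPMF id x).toOuterMeasure Set.univ :=
          (A.outputPMF id x).toOuterMeasure.mono (Set.subset_univ _)
      _ = 1 := (PMF.toOuterMeasure_apply_eq_one_iff _ _).2 (Set.subset_univ _)
  exact ⟨A, hA, hq, fun x hx => (hAy x hx).trans (mono x fun y hy' => hy hy'),
    fun x hx => (hAn x hx).trans (mono x fun y hn' => hn hn')⟩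

end Literature.Algebra.EuclideanLattices

namespace Literature.Algebra.EuclideanLattices

/-! ### `GapSVP`: a larger gap serves every smaller one, also for randomised reductions -/

/-- The yes-instances of `gapSVPPromise γ` do not depend on `γ` (`GapSVP.yes_eq_yes`).
[Micciancio–Goldwasser 2002, Ch. 1, §1.2] [cite: MicciancioGoldwasser2002, Ch. 1 §1.2] -/
theorem gapSVPPromise_yes_eq_yes (γ γ' : ℕ → ℝ) : (gapSVPPromise γ).yes = (gapSVPPromise γ').yes :=
  rfl

/-- For `γ ≤ γ'` pointwise, NO instances of `GapSVP_{γ'}` are NO instances of `GapSVP_γ`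
(`GapSVP.no_subset_no_of_le` through the encoding). [Micciancio–Goldwasser 2002, Ch. 1, §1.2] [cite: MicciancioGoldwasser2002, Ch. 1 §1.2] -/
theorem gapSVPPromise_no_subset_no_of_le {γ γ' : ℕ → ℝ} (h : γ ≤ γ') :
    (gapSVPPromise γ').no ≤ (gapSVPPromise γ).no := by
  rintro _ ⟨p, hp, rfl⟩
  exact ⟨p, GapSVP.no_subset_no_of_le h hp, rfl⟩

/-- A randomised reduction to `GapSVP_{γ'}` is a randomised reduction to `GapSVP_γ` for every
pointwise smaller factor `γ ≤ γ'` (same algorithm; the target promise is only weakened,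
`PromiseRandReducible.mono_right`). The randomised companion of
`gapSVPPromise_polyTimeReducible_of_le`. [Micciancio–Goldwasser 2002, Ch. 1, §1.2; Arora–Barak
2009, §7.6] [cite: MicciancioGoldwasser2002, Ch. 1 §1.2] -/
theorem promiseRandReducible_gapSVP_of_le {Q : PromiseProblem} {γ γ' : ℕ → ℝ} (h : γ ≤ γ')
    (hr : PromiseRandReducible Q (gapSVPPromise γ')) : PromiseRandReducible Q (gapSVPPromise γ) :=
  hr.mono_right (gapSVPPromise_yes_eq_yes γ' γ).le (gapSVPPromise_no_subset_no_of_le h)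

/-! ### The named fact: Khot's randomised reduction from `SAT` to constant-factor `GapSVP` -/

/-- **Khot 2005, Thm. 1.1, first assertion, Euclidean norm (`p = 2`), in the reduction form in
which it is proved (§7.3).** For every constant `γ₀ ≥ 1` there is a randomised polynomial-time
many-one reduction with two-sided bounded error — a PPT algorithm `A(x; r)` reading exactly
`q(|x|)` coins, `Literature.Computability.MetaComplexity.PromiseRandReducible` — from `SAT` (as the promise problem
`ofLanguage SAT`: yes = the `encodingCNF`-codes of satisfiable CNF formulas, no = all other
strings) to `GapSVP_{γ₀}` (`gapSVPPromise fun _ => γ₀`: square nonsingular integer bases, rational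
threshold, Euclidean `λ₁`): `x ∈ SAT → Pr_r[A(x; r) ∈ GapSVP_{γ₀}.YES] ≥ 2/3` and
`x ∉ SAT → Pr_r[A(x; r) ∈ GapSVP_{γ₀}.NO] ≥ 2/3`.

Printed (p. 791): "Let `p > 1` be any fixed real. Assuming NP ⊄ RP, there is no polynomial time
algorithm that approximates the Shortest Vector Problem in `ℓ_p` norm within (any) constant
factor"; proved (§7.3, p. 806) by exhibiting, for every constant `k`, a randomised reduction
SAT →(Thm. 3.1) CVP →(Thm. 5.1: YES ↦ YES and NO ↦ NO each with probability `≥ 9/10`) SVP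
→(`k`-fold augmented tensor product, Lemmas 7.1–7.2) `GapSVP` with gap `(1/(2γ^k))^{1/p} =
2^{Ω(k)}`, running in time `n^{O(k²)}`: "choosing `k` to be a large enough constant, we prove an
arbitrarily large constant factor hardness for SVP via a polynomial-time (randomized) reduction".
Read through the conventions 1–3 of the module docstring (square bases by orthogonal padding in
`ℓ₂`; rational threshold between the bounds of Lemmas 7.1 and 7.2; every constant from
arbitrarily large constants, `khot2005_SAT_randReducible_gapSVP_iff`; non-codes to a fixed NO
instance; padded coins). The second assertion of Thm. 1.1 (factor `2^{(log n)^{1/2-ε}}` under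
NP ⊄ RTIME(`2^{poly(log n)}`)) and the norms `p ≠ 2` are not vendored. (For `γ₀ < √2` the
hardness is also Micciancio's, SIAM J. Comput. 30 (2001), by RUR-reductions; not used here.)
[cite: Khot2005, Thm. 1.1 and §7.3] -/
def Khot2005_SAT_randReducible_gapSVP : Prop :=
  ∀ γ₀ : ℝ, 1 ≤ γ₀ → PromiseRandReducible (ofLanguage SAT) (gapSVPPromise fun _ => γ₀)

/-- "Every constant `γ₀ ≥ 1`" (the vendored form) is equivalent to Khot's printed "arbitrarily
large constant factor" (§7.3): reductions to `GapSVP_γ` for unboundedly many constants `γ`; by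
`promiseRandReducible_gapSVP_of_le`. [cite: Khot2005, §7.3] -/
theorem khot2005_SAT_randReducible_gapSVP_iff :
    Khot2005_SAT_randReducible_gapSVP ↔
      ∀ γ₀ : ℝ, ∃ γ : ℝ, γ₀ ≤ γ ∧ PromiseRandReducible (ofLanguage SAT) (gapSVPPromise fun _ => γ) := by
  constructor
  · intro h γ₀
    exact ⟨max γ₀ 1, le_max_left _ _, h _ (le_max_right _ _)⟩
  · intro h γ₀ _
    obtain ⟨γ, hγ, hr⟩ := h γ₀
    exact promiseRandReducible_gapSVP_of_le (fun _ => hγ) hr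

/-- Each instance of Khot's fact gives randomised NP-hardness of that `GapSVP_γ`
(`PromiseProblem.isNPHardRandomized_of_promiseRandReducible_SAT`: Cook–Levin + composition).
[Khot 2005, Thm. 1.1; Arora–Barak 2009, Lemma 2.11 and §7.6] [cite: Khot2005, Thm. 1.1] -/
theorem isNPHardRandomized_gapSVP_of_SAT_randReducible {γ : ℕ → ℝ}
    (h : PromiseRandReducible (ofLanguage SAT) (gapSVPPromise γ)) :
    (gapSVPPromise γ).IsNPHardRandomized :=
  PromiseProblem.isNPHardRandomized_of_promiseRandReducible_SAT h

/-- **The decomposition of pqc.S17.** Khot's randomised reduction from `SAT`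
(`Khot2005_SAT_randReducible_gapSVP`) implies the target fact
`gapSVP_const_isNPHardRandomized` of `LatticeComplexity.lean` — for every constant `γ₀ ≥ 1`,
`GapSVP_{γ₀}` is NP-hard under randomised (two-sided bounded-error) polynomial-time many-one
reductions — by the Cook–Levin theorem (`Literature.Computability.Complexity.SAT_isNPHard_holds`) and composition of a Karp
reduction with a randomised one (`PromiseRandReducible.of_isHard`), both proved in the tree.
[Khot 2005, Thm. 1.1 and §7.3; Arora–Barak 2009, Lemma 2.11, Thm. 2.8, §7.6] [cite: Khot2005, Thm. 1.1 and §7.3] -/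
theorem gapSVP_const_isNPHardRandomized_of_SAT_randReducible
    (h : Khot2005_SAT_randReducible_gapSVP) : gapSVP_const_isNPHardRandomized :=
  fun γ₀ hγ₀ => isNPHardRandomized_gapSVP_of_SAT_randReducible (h γ₀ hγ₀)

/-- Pointwise form with the weakest useful hypothesis: randomised NP-hardness of `GapSVP_{γ₀}`
for ALL constants `γ₀ ≥ 1` already follows from Khot's reductions for an unbounded set of
constants. [Khot 2005, §7.3] [cite: Khot2005, §7.3] -/
theorem gapSVP_const_isNPHardRandomized_of_frequently
    (h : ∀ γ₀ : ℝ, ∃ γ : ℝ, γ₀ ≤ γ ∧ PromiseRandReducible (ofLanguage SAT) (gapSVPPromise fun _ => γ)) :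
    gapSVP_const_isNPHardRandomized :=
  gapSVP_const_isNPHardRandomized_of_SAT_randReducible (khot2005_SAT_randReducible_gapSVP_iff.2 h)

end Literature.Algebra.EuclideanLattices
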